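import Literature.MathematicalPhysics.KineticTheory.LangevinChainNESSProofs
import Mathlib.Analysis.Calculus.LineDeriv.IntegrationByParts
import Mathlib.Analysis.SpecialFunctions.Gaussian.GaussianIntegral
import Mathlib.MeasureTheory.Integral.Pi
import Mathlib.MeasureTheory.Measure.Tilted
import Mathlib.MeasureTheory.Group.Integral
import HarnessLib

/-!
# The Gibbs state of the Langevin-driven pinned chain (equilibrium anchor, proved)

Trunk T-KINETIC (Literature/MathematicalPhysics/KineticTheory). Companion of
`LangevinChainNESS.lean` / `LangevinChainNESSProofs.lean`: the EQUILIBRIUM part of the existence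
theory of steady states of the chain `Literature.HeatConduction.pinnedChain ω₂ lam β γ` between Langevin
heat baths (`FouriersLaw.lean`), with complete proofs and an explicit witness (the Gibbs
measure), independent of the semigroup interface.

## Source and content

Cuneo–Eckmann–Hairer–Rey-Bellet, *Non-equilibrium steady states for networks of oscillators*,
Electron. J. Probab. 23 (2018) no. 55, §3.1, proof of Prop. 3.3 (p. 8): for the Langevin system
(2.2) in which "all the temperatures have been replaced by `1/β`", "it is well known that the
measure `dμ_β = Z⁻¹ e^{-βH(p,q)} dp dq` is invariant … (The invariance of `μ_β` can be seen by
checking that `L* e^{-βH} = 0`, where `L*` is the formal adjoint of the generator)"; and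
Thm 2.13(2) (p. 6): "`e^{θH}` is integrable with respect to [the invariant measure] for all
`0 < θ < 1/T_max`". Bonetto–Lebowitz–Rey-Bellet 2000, §4.1: at equal bath temperatures the
Gibbs measure is stationary; §5.2: the heat current vanishes at equilibrium.

For a general `OscillatorChain P` with `C¹` potentials we prove the weak form of
`L* e^{-H/T} = 0` coordinate by coordinate (two integrations by parts per site, Mathlib's
`integral_bilinear_hasLineDerivAt_right_eq_neg_left_of_integrable`):

* `integral_liouville_mul_gibbsDensity`: `∫ (p_i ∂_{q_i} f - ∂_{q_i}H ∂_{p_i} f) e^{-H/T} = 0`;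
* `integral_bath_mul_gibbsDensity`:
  `∫ (T_b ∂²_{p_i} f - p_i ∂_{p_i} f) e^{-H/T} = (T_b/T - 1) ∫ p_i ∂_{p_i} f e^{-H/T}`;
* `integral_generator_mul_gibbsDensity`: hence, for the generator `L_{T_L,T_R}` of
  `FouriersLaw.lean` and `f ∈ C²_c`,
  `∫ (L f) e^{-H/T} = γ ∑_i ([i=0](T_L/T-1) + [i=N-1](T_R/T-1)) ∫ p_i ∂_{p_i} f e^{-H/T}`.

For the pinned anharmonic chain (`ω₂ > 0`, `lam, β ≥ 0`, any `γ`) we add the integrability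
(`H ≥ ∑ (ω₂q_i² + p_i²)/2`, domination by Gaussians; `|j_i| ≤ N(3+β)/2 (1+H)²` from
`LangevinChainNESSProofs.lean`) and obtain:

* `pinnedChain_isSteadyState_gibbsMeasure`: for `T_L = T_R = T > 0` and every `N` the Gibbs
  measure `gibbsMeasure = Z⁻¹ e^{-H/T} dq dp` is an `OscillatorChain.IsSteadyState`;
* `pinnedChain_isSteadyState_gibbsMeasure_one`: for `N = 1` and ALL `T_L, T_R > 0` the Gibbs
  measure at the mean temperature `(T_L+T_R)/2` is a steady state (both baths act on `p_0`);
* `pinnedChain_integrable_exp_mul_hamiltonian_gibbsMeasure`: `e^{ϑH} ∈ L¹(μ_T)` for `ϑ < 1/T`;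
* `pinnedChain_totalCurrent_gibbsMeasure`: no heat current at equilibrium (momentum reversal);
* `CuneoEckmannHairerReyBellet2018_pinnedChain_of_eq` / `…_one`: the conclusion of the named
  fact `CuneoEckmannHairerReyBellet2018_pinnedChain` (`LangevinChainNESS.lean`) PROVED OUTRIGHT
  (no named-fact hypothesis) in the equilibrium case `T_L = T_R` (all `N`) and for `N = 1`
  (all `T_L, T_R`).

## What is NOT here

The non-equilibrium case `T_L ≠ T_R`, `N ≥ 2` has no closed-form steady state; there the named
fact is reduced to Theorem 2.13 itself (`CuneoEckmannHairerReyBellet2018_pinnedChain_of_thm213`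
in `LangevinChainNESSProofs.lean`), whose proof (Hörmander bracket condition + Lyapunov function
`e^{θH}` for the Markov semigroup + Harris theorem) needs the SDE/semigroup layer absent from
Mathlib.

## Design choices

* `gibbsMeasure P N T := volume.tilted (-H/T)` — Mathlib's exponentially tilted measure
  (`Mathlib/MeasureTheory/Measure/Tilted.lean`; the tree's convention for Gibbs measures, cf.
  `Literature/Barriers/CriticalPhenomena/RigorousRGSmallParameter.lean`): the probability
  measure with Lebesgue density `e^{-H/T}/∫e^{-H/T}` when `e^{-H/T}` is integrable, `0`
  otherwise; absolute continuity, the probability property, `∫ g dμ_T` and integrability come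
  from the `tilted` API (`tilted_absolutelyContinuous`, `isProbabilityMeasure_tilted`,
  `integral_tilted`, `integrable_tilted_iff`). The partition function
  `partitionFunction P N T := ∫⁻ ofReal e^{-H/T} ∈ [0, ∞]` is kept, with the bridge
  `gibbsMeasure_eq_smul_withDensity : gibbsMeasure = Z⁻¹ • (e^{-H/T} · volume)` under
  integrability — defined for every `OscillatorChain`.
* `partialQ/partialP` of `FouriersLaw.lean` are Mathlib line derivatives along the coordinate
  vectors `(e_i, 0)`, `(0, e_i)` (`LangevinChainNESSProofs.lean`), so the integrations by parts
  are instances of Mathlib's line-derivative version on the additive Haar measure `volume` of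
  phase space; `OscillatorChain.potential` (the potential energy `Φ(q)`) splits `H = ∑p²/2 + Φ`
  to compute `∂_{p_i}H = p_i` and the `p`-independence of `∂_{q_i}H`.
* Hypotheses are the weakest the proofs use: `C¹` potentials for the identities, `f ∈ C²_c`
  (the predicate `IsSteadyState` quantifies over `C_c^∞`), `lam, β ≥ 0` (the named fact has
  `lam, β > 0`), `γ : ℝ` arbitrary (at equal temperatures each bath term vanishes separately).
-/

noncomputable section

open MeasureTheory
open scoped ContDiff

namespace Literature.MathematicalPhysics.KineticTheory.HeatConduction

variable {N : ℕ}

namespace OscillatorChain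

variable (P : OscillatorChain)

/-! ### Kinetic/potential splitting of the Hamiltonian; `∂_{p_i}H = p_i`, `∂_{q_i}H = ∂_{q_i}Φ` -/

/-- The potential energy `Φ(q) = ∑_i U(q_i) + ∑_{bonds (i,i+1)} V(q_{i+1} - q_i)` of the `N`-site
chain. [Bonetto–Lebowitz–Rey-Bellet 2000, §3 eq. (8)] [folklore] -/
def potential (N : ℕ) (q : Fin N → ℝ) : ℝ :=
  (∑ i, P.U (q i)) + ∑ i : Fin N, ∑ j : Fin N, if j.val = i.val + 1 then P.V (q j - q i) else 0

/-- `H(q, p) = ∑_i p_i²/2 + Φ(q)`. [folklore] -/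
theorem hamiltonian_eq_kinetic_add_potential (N : ℕ) (x : PhaseSpace N) :
    P.hamiltonian N x = (∑ i, x.2 i ^ 2 / 2) + P.potential N x.1 := by
  simp only [hamiltonian, potential, Finset.sum_add_distrib]
  ring

/-- `∂_{p_i} H = p_i` (no hypothesis on the potentials). [folklore] -/
theorem hasLineDerivAt_hamiltonian_unitP (N : ℕ) (x : PhaseSpace N) (i : Fin N) :
    HasLineDerivAt ℝ (P.hamiltonian N) (x.2 i) x ((0, Pi.single i 1) : PhaseSpace N) := by
  unfold HasLineDerivAt
  have h : (fun t : ℝ => P.hamiltonian N (x + t • ((0, Pi.single i 1) : PhaseSpace N))) =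
      fun t => (x.2 i + t) ^ 2 / 2 +
        ((∑ k ∈ Finset.univ.erase i, x.2 k ^ 2 / 2) + P.potential N x.1) := by
    funext t
    rw [hamiltonian_eq_kinetic_add_potential, add_smul_unitP_fst, add_smul_unitP_snd,
      add_smul_single_eq_update, ← Finset.add_sum_erase _ _ (Finset.mem_univ i),
      Function.update_self, add_assoc]
    congr 2
    exact Finset.sum_congr rfl fun k hk => by rw [Function.update_of_ne (Finset.ne_of_mem_erase hk)]
  rw [h]
  apply HasDerivAt.add_const
  have h1 : HasDerivAt (fun t : ℝ => x.2 i + t) 1 0 := (hasDerivAt_id' (0 : ℝ)).const_add _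
  refine ((h1.pow 2).div_const 2).congr_deriv ?_
  norm_num

/-- `∂_{p_i} H = p_i`. [folklore] -/
theorem partialP_hamiltonian (N : ℕ) (x : PhaseSpace N) (i : Fin N) :
    partialP i (P.hamiltonian N) x = x.2 i := by
  rw [partialP_eq_lineDeriv]
  exact (P.hasLineDerivAt_hamiltonian_unitP N x i).lineDeriv

/-- `∂_{q_i} H` depends on the positions only: it is the `q_i`-derivative of the potential energy.
[folklore] -/
theorem partialQ_hamiltonian_eq (N : ℕ) (x : PhaseSpace N) (i : Fin N) :
    partialQ i (P.hamiltonian N) x =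
      deriv (fun t => P.potential N (Function.update x.1 i t)) (x.1 i) := by
  unfold partialQ
  simp_rw [hamiltonian_eq_kinetic_add_potential]
  exact deriv_const_add _

/-- `∂_{q_i} H` is constant along the momentum directions. [folklore] -/
theorem partialQ_hamiltonian_add_smul_unitP (N : ℕ) (x : PhaseSpace N) (i j : Fin N) (t : ℝ) :
    partialQ i (P.hamiltonian N) (x + t • ((0, Pi.single j 1) : PhaseSpace N)) =
      partialQ i (P.hamiltonian N) x := by
  rw [partialQ_hamiltonian_eq, partialQ_hamiltonian_eq, add_smul_unitP_fst]

/-- For a differentiable Hamiltonian, `∂_{q_i} H` is its line derivative along `(e_i, 0)`.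
[folklore] -/
theorem hasLineDerivAt_hamiltonian_unitQ {N : ℕ} (hH : Differentiable ℝ (P.hamiltonian N))
    (x : PhaseSpace N) (i : Fin N) :
    HasLineDerivAt ℝ (P.hamiltonian N) (partialQ i (P.hamiltonian N) x) x
      ((Pi.single i 1, 0) : PhaseSpace N) := by
  rw [partialQ_eq_lineDeriv]
  exact (hH x).lineDifferentiableAt.hasLineDerivAt

/-! ### The Gibbs density `e^{-H/T}` -/

/-- The Boltzmann–Gibbs density `ρ_T(q, p) = e^{-H(q,p)/T}` of the `N`-site chain at temperature
`T` (meaningful for `T > 0`; at `T = 0` Lean's `x / 0 = 0` gives the junk value `ρ_0 = 1`, and for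
`T < 0` the weight `e^{+H/|T|}`). [Bonetto–Lebowitz–Rey-Bellet 2000, §4.1;
Cuneo–Eckmann–Hairer–Rey-Bellet 2018, §3.1] [folklore] -/
def gibbsDensity (N : ℕ) (T : ℝ) (x : PhaseSpace N) : ℝ :=
  Real.exp (-P.hamiltonian N x / T)

/-- `e^{-H/T} > 0`. [folklore] -/
theorem gibbsDensity_pos (N : ℕ) (T : ℝ) (x : PhaseSpace N) : 0 < P.gibbsDensity N T x :=
  Real.exp_pos _

/-- `e^{-H/T}` is continuous if the potentials are. [folklore] -/
theorem continuous_gibbsDensity (hU : Continuous P.U) (hV : Continuous P.V) (N : ℕ) (T : ℝ) :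
    Continuous (P.gibbsDensity N T) :=
  Real.continuous_exp.comp (((P.continuous_hamiltonian hU hV N).neg).div_const T)

/-- Chain rule: along any direction, `∂_v e^{-H/T} = -(∂_v H / T) e^{-H/T}`. [folklore] -/
theorem hasLineDerivAt_gibbsDensity {N : ℕ} {T D : ℝ} {x v : PhaseSpace N}
    (hH : HasLineDerivAt ℝ (P.hamiltonian N) D x v) :
    HasLineDerivAt ℝ (P.gibbsDensity N T) (-(D / T) * P.gibbsDensity N T x) x v := by
  unfold HasLineDerivAt gibbsDensity at *
  refine ((hH.neg.div_const T).exp).congr_deriv ?_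
  simp only [Pi.neg_apply, zero_smul, add_zero]
  ring

/-- The partition function `Z_N(T) = ∫ e^{-H/T} dq dp ∈ [0, ∞]` (a lower Lebesgue integral).
[Bonetto–Lebowitz–Rey-Bellet 2000, §4.1] [folklore] -/
def partitionFunction (N : ℕ) (T : ℝ) : ENNReal := ∫⁻ x, ENNReal.ofReal (P.gibbsDensity N T x)

/-- The Gibbs (canonical equilibrium) measure `Z⁻¹ e^{-H/T} dq dp` of the `N`-site chain at
temperature `T`: Lebesgue measure on phase space exponentially tilted by `-H/T` (Mathlib's
`Measure.tilted`, the tree's convention for Gibbs measures), i.e. the probability measure with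
Lebesgue density `e^{-H/T} / ∫ e^{-H/T}` when `e^{-H/T}` is integrable, and the zero measure
otherwise. [Bonetto–Lebowitz–Rey-Bellet 2000, §4.1; Cuneo–Eckmann–Hairer–Rey-Bellet 2018, §3.1
(proof of Prop. 3.3)] [folklore] -/
def gibbsMeasure (N : ℕ) (T : ℝ) : Measure (PhaseSpace N) :=
  (volume : Measure (PhaseSpace N)).tilted fun x => -P.hamiltonian N x / T

/-! ### General facts on the Gibbs measure (from Mathlib's `Measure.tilted` API) -/

/-- Unfolding: `gibbsMeasure = volume.tilted (-H/T)`. [folklore] -/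
theorem gibbsMeasure_eq (N : ℕ) (T : ℝ) :
    P.gibbsMeasure N T = (volume : Measure (PhaseSpace N)).tilted fun x => -P.hamiltonian N x / T :=
  rfl

/-- The tilting density is the Gibbs density: `e^{(-H/T)(x)} = gibbsDensity x`. [folklore] -/
theorem exp_neg_hamiltonian_div (N : ℕ) (T : ℝ) (x : PhaseSpace N) :
    Real.exp (-P.hamiltonian N x / T) = P.gibbsDensity N T x := rfl

/-- The Gibbs measure is absolutely continuous with respect to Lebesgue measure. [folklore] -/
theorem gibbsMeasure_absolutelyContinuous (N : ℕ) (T : ℝ) : P.gibbsMeasure N T ≪ volume :=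
  tilted_absolutelyContinuous _ _

/-- If `e^{-H/T}` is not Lebesgue integrable the Gibbs measure is the zero measure (Mathlib's
convention for `Measure.tilted`). [folklore] -/
theorem gibbsMeasure_of_not_integrable {N : ℕ} {T : ℝ} (h : ¬ Integrable (P.gibbsDensity N T)) :
    P.gibbsMeasure N T = 0 :=
  tilted_of_not_integrable h

/-- If `e^{-H/T}` is Lebesgue integrable the Gibbs measure is a probability measure. [folklore] -/
theorem isProbabilityMeasure_gibbsMeasure {N : ℕ} {T : ℝ} (h : Integrable (P.gibbsDensity N T)) :
    IsProbabilityMeasure (P.gibbsMeasure N T) :=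
  isProbabilityMeasure_tilted h

/-- Integrals against the Gibbs measure are `(∫ e^{-H/T})⁻¹ ∫ (·) e^{-H/T} dq dp` (both sides
vanish when `e^{-H/T}` is not integrable). [folklore] -/
theorem integral_gibbsMeasure {N : ℕ} {T : ℝ} (g : PhaseSpace N → ℝ) :
    ∫ x, g x ∂(P.gibbsMeasure N T) =
      (∫ x, P.gibbsDensity N T x)⁻¹ * ∫ x, g x * P.gibbsDensity N T x := by
  rw [gibbsMeasure_eq, integral_tilted, ← integral_const_mul]
  refine integral_congr_ae (Filter.Eventually.of_forall fun x => ?_)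
  simp only [smul_eq_mul, exp_neg_hamiltonian_div]
  ring

/-- Integrability against the Gibbs measure from Lebesgue integrability of `g e^{-H/T}`.
[folklore] -/
theorem integrable_gibbsMeasure {N : ℕ} {T : ℝ} {g : PhaseSpace N → ℝ}
    (hg : Integrable (fun x => g x * P.gibbsDensity N T x)) :
    Integrable g (P.gibbsMeasure N T) := by
  by_cases h : Integrable (P.gibbsDensity N T)
  · rw [gibbsMeasure_eq, integrable_tilted_iff h]
    refine hg.congr (Filter.Eventually.of_forall fun x => ?_)
    simp only [smul_eq_mul, exp_neg_hamiltonian_div]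
    ring
  · rw [P.gibbsMeasure_of_not_integrable h]
    exact integrable_zero_measure

/-- Measurability of the `ℝ≥0∞`-valued Gibbs density. [folklore] -/
theorem measurable_gibbsDensity_ofReal {N : ℕ} {T : ℝ} (hρ : Continuous (P.gibbsDensity N T)) :
    Measurable fun x => ENNReal.ofReal (P.gibbsDensity N T x) :=
  hρ.measurable.ennreal_ofReal

/-- `Z < ∞` as soon as `e^{-H/T}` is integrable. [folklore] -/
theorem partitionFunction_ne_top {N : ℕ} {T : ℝ} (h : Integrable (P.gibbsDensity N T)) :
    P.partitionFunction N T ≠ ⊤ :=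
  ((hasFiniteIntegral_iff_ofReal (Filter.Eventually.of_forall fun x =>
    (P.gibbsDensity_pos N T x).le)).mp h.hasFiniteIntegral).ne

/-- `Z > 0` (the density is positive and Lebesgue measure charges open sets). [folklore] -/
theorem partitionFunction_ne_zero {N : ℕ} {T : ℝ} (hρ : Continuous (P.gibbsDensity N T)) :
    P.partitionFunction N T ≠ 0 := by
  have hpos : 0 < P.partitionFunction N T := by
    unfold partitionFunction
    rw [lintegral_pos_iff_support (P.measurable_gibbsDensity_ofReal hρ)]
    have : Function.support (fun x => ENNReal.ofReal (P.gibbsDensity N T x)) = Set.univ := by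
      ext x; simp [P.gibbsDensity_pos N T x]
    rw [this]
    exact isOpen_univ.measure_pos volume Set.univ_nonempty
  exact hpos.ne'

/-- `Z = ofReal (∫ e^{-H/T})` when `e^{-H/T}` is integrable. [folklore] -/
theorem partitionFunction_eq_ofReal_integral {N : ℕ} {T : ℝ} (h : Integrable (P.gibbsDensity N T)) :
    P.partitionFunction N T = ENNReal.ofReal (∫ x, P.gibbsDensity N T x) :=
  (ofReal_integral_eq_lintegral_ofReal h
    (Filter.Eventually.of_forall fun x => (P.gibbsDensity_pos N T x).le)).symm

/-- Bridge to the partition-function normalisation: when `e^{-H/T}` is integrable,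
`gibbsMeasure = Z⁻¹ • (e^{-H/T} · Lebesgue)`. [Bonetto–Lebowitz–Rey-Bellet 2000, §4.1]
[folklore] -/
theorem gibbsMeasure_eq_smul_withDensity {N : ℕ} {T : ℝ} (h : Integrable (P.gibbsDensity N T)) :
    P.gibbsMeasure N T = (P.partitionFunction N T)⁻¹ •
      volume.withDensity fun x => ENNReal.ofReal (P.gibbsDensity N T x) := by
  have hpos : 0 < ∫ x, P.gibbsDensity N T x := integral_exp_pos h
  rw [gibbsMeasure_eq, Measure.tilted, P.partitionFunction_eq_ofReal_integral h,
    ← withDensity_smul' _ _ (ENNReal.inv_ne_top.mpr (ENNReal.ofReal_pos.mpr hpos).ne')]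
  congr 1
  funext x
  show ENNReal.ofReal (P.gibbsDensity N T x / ∫ y, P.gibbsDensity N T y) =
    (ENNReal.ofReal (∫ y, P.gibbsDensity N T y))⁻¹ * ENNReal.ofReal (P.gibbsDensity N T x)
  rw [ENNReal.ofReal_div_of_pos hpos, div_eq_mul_inv, mul_comm]

/-! ### Integration by parts against the Gibbs density -/

/-- Integration by parts along a direction `v` of phase space, for a continuous `F` with a
continuous line derivative `F'` against a compactly supported `C¹` test function `g`:
`∫ F ∂_v g = -∫ (∂_v F) g` (Lebesgue measure). [folklore] -/
theorem _root_.Literature.MathematicalPhysics.KineticTheory.HeatConduction.integral_mul_eq_neg_of_hasLineDerivAt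
    {F F' g g' : PhaseSpace N → ℝ} {v : PhaseSpace N}
    (hF : Continuous F) (hF' : Continuous F') (hg : Continuous g) (hg' : Continuous g')
    (hgc : HasCompactSupport g) (hg'c : HasCompactSupport g')
    (hFd : ∀ x, HasLineDerivAt ℝ F (F' x) x v) (hgd : ∀ x, HasLineDerivAt ℝ g (g' x) x v) :
    ∫ x, F x * g' x = -∫ x, F' x * g x := by
  haveI := isAddHaarMeasure_volume_phaseSpace N
  have e := integral_bilinear_hasLineDerivAt_right_eq_neg_left_of_integrable
    (μ := (volume : Measure (PhaseSpace N))) (B := ContinuousLinearMap.mul ℝ ℝ)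
    (f := F) (f' := F') (g := g) (g' := g') (v := v) ?_ ?_ ?_ (fun x _ => hFd x) (fun x _ => hgd x)
  · simpa using e
  · exact (hF'.mul hg).integrable_of_hasCompactSupport hgc.mul_left
  · exact (hF.mul hg').integrable_of_hasCompactSupport hg'c.mul_left
  · exact (hF.mul hg).integrable_of_hasCompactSupport hgc.mul_left

/-- **Liouville part.** The Hamiltonian vector field preserves `e^{-H/T} dq dp` weakly:
`∫ (p_i ∂_{q_i} f - ∂_{q_i}H ∂_{p_i} f) e^{-H/T} = 0` for `f ∈ C¹_c`, for every site `i` (two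
integrations by parts: `∂_{q_i} e^{-H/T} = -(∂_{q_i}H/T) e^{-H/T}`,
`∂_{p_i} e^{-H/T} = -(p_i/T) e^{-H/T}`). [Cuneo–Eckmann–Hairer–Rey-Bellet 2018, §3.1, proof of
Prop. 3.3 ("`L* e^{-βH} = 0`")] [folklore] -/
theorem integral_liouville_mul_gibbsDensity (hU : ContDiff ℝ 1 P.U) (hV : ContDiff ℝ 1 P.V)
    (N : ℕ) (T : ℝ) {f : PhaseSpace N → ℝ} (hf : ContDiff ℝ 1 f) (hfc : HasCompactSupport f)
    (i : Fin N) :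
    ∫ x, (x.2 i * partialQ i f x - partialQ i (P.hamiltonian N) x * partialP i f x) *
      P.gibbsDensity N T x = 0 := by
  have hH1 : ContDiff ℝ 1 (P.hamiltonian N) := P.contDiff_hamiltonian hU hV N
  have hHd : Differentiable ℝ (P.hamiltonian N) := hH1.differentiable one_ne_zero
  have hfd : Differentiable ℝ f := hf.differentiable one_ne_zero
  have hρc : Continuous (P.gibbsDensity N T) :=
    P.continuous_gibbsDensity hU.continuous hV.continuous N T
  have hWc : Continuous (partialQ i (P.hamiltonian N)) := P.continuous_partialQ_hamiltonian hH1 i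
  have hQc : Continuous (partialQ i f) := continuous_partialQ hf one_ne_zero i
  have hPc : Continuous (partialP i f) := continuous_partialP hf one_ne_zero i
  have e1 : ∫ x, (x.2 i * P.gibbsDensity N T x) * partialQ i f x =
      -∫ x, (x.2 i * (-(partialQ i (P.hamiltonian N) x / T) * P.gibbsDensity N T x)) * f x := by
    apply integral_mul_eq_neg_of_hasLineDerivAt (v := ((Pi.single i 1, 0) : PhaseSpace N))
    · fun_prop
    · fun_prop
    · exact hf.continuous
    · exact hQc
    · exact hfc
    · exact hasCompactSupport_partialQ hfd hfc i
    · intro x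
      have hρ' := P.hasLineDerivAt_gibbsDensity (T := T)
        (P.hasLineDerivAt_hamiltonian_unitQ hHd x i)
      unfold HasLineDerivAt at hρ' ⊢
      simp only [add_smul_unitQ_snd]
      exact hρ'.const_mul (x.2 i)
    · exact fun x => hasLineDerivAt_partialQ hfd i x
  have e2 : ∫ x, (partialQ i (P.hamiltonian N) x * P.gibbsDensity N T x) * partialP i f x =
      -∫ x, (partialQ i (P.hamiltonian N) x * (-(x.2 i / T) * P.gibbsDensity N T x)) * f x := by
    apply integral_mul_eq_neg_of_hasLineDerivAt (v := ((0, Pi.single i 1) : PhaseSpace N))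
    · fun_prop
    · fun_prop
    · exact hf.continuous
    · exact hPc
    · exact hfc
    · exact hasCompactSupport_partialP hfd hfc i
    · intro x
      have hρ' := P.hasLineDerivAt_gibbsDensity (T := T) (P.hasLineDerivAt_hamiltonian_unitP N x i)
      unfold HasLineDerivAt at hρ' ⊢
      simp only [partialQ_hamiltonian_add_smul_unitP]
      exact hρ'.const_mul _
    · exact fun x => hasLineDerivAt_partialP hfd i x
  have hsplit : (fun x => (x.2 i * partialQ i f x -
      partialQ i (P.hamiltonian N) x * partialP i f x) * P.gibbsDensity N T x) =
      fun x => (x.2 i * P.gibbsDensity N T x) * partialQ i f x -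
        (partialQ i (P.hamiltonian N) x * P.gibbsDensity N T x) * partialP i f x := by
    funext x; ring
  rw [hsplit, integral_sub, e1, e2]
  · have : (fun x => (x.2 i * (-(partialQ i (P.hamiltonian N) x / T) * P.gibbsDensity N T x)) *
        f x) = fun x => (partialQ i (P.hamiltonian N) x * (-(x.2 i / T) *
          P.gibbsDensity N T x)) * f x := by
      funext x; ring
    rw [this, sub_self]
  · exact ((by fun_prop : Continuous fun x => x.2 i * P.gibbsDensity N T x).mul
      hQc).integrable_of_hasCompactSupport (hasCompactSupport_partialQ hfd hfc i).mul_left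
  · exact ((hWc.mul hρc).mul hPc).integrable_of_hasCompactSupport
      (hasCompactSupport_partialP hfd hfc i).mul_left

/-- **Ornstein–Uhlenbeck (bath) part.** For a Langevin bath at temperature `T_b` acting on the
momentum `p_i`, `∫ (T_b ∂²_{p_i} f - p_i ∂_{p_i} f) e^{-H/T} = (T_b/T - 1) ∫ p_i ∂_{p_i} f e^{-H/T}`
for `f ∈ C²_c`; in particular it vanishes when `T_b = T` (fluctuation–dissipation).
[Cuneo–Eckmann–Hairer–Rey-Bellet 2018, §3.1, proof of Prop. 3.3] [folklore] -/
theorem integral_bath_mul_gibbsDensity (hU : ContDiff ℝ 1 P.U) (hV : ContDiff ℝ 1 P.V)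
    (N : ℕ) (T T_b : ℝ) {f : PhaseSpace N → ℝ} (hf : ContDiff ℝ 2 f) (hfc : HasCompactSupport f)
    (i : Fin N) :
    ∫ x, (T_b * partialP i (partialP i f) x - x.2 i * partialP i f x) * P.gibbsDensity N T x =
      (T_b / T - 1) * ∫ x, x.2 i * partialP i f x * P.gibbsDensity N T x := by
  have hfd : Differentiable ℝ f := hf.differentiable two_ne_zero
  have hg : ContDiff ℝ 1 (partialP i f) := contDiff_partialP hf (by norm_num) i
  have hgd : Differentiable ℝ (partialP i f) := hg.differentiable one_ne_zero
  have hgc : HasCompactSupport (partialP i f) := hasCompactSupport_partialP hfd hfc i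
  have hg'c : HasCompactSupport (partialP i (partialP i f)) := hasCompactSupport_partialP hgd hgc i
  have hgC : Continuous (partialP i f) := hg.continuous
  have hg'C : Continuous (partialP i (partialP i f)) := continuous_partialP hg one_ne_zero i
  have hρc : Continuous (P.gibbsDensity N T) :=
    P.continuous_gibbsDensity hU.continuous hV.continuous N T
  have e : ∫ x, P.gibbsDensity N T x * partialP i (partialP i f) x =
      -∫ x, (-(x.2 i / T) * P.gibbsDensity N T x) * partialP i f x := by
    apply integral_mul_eq_neg_of_hasLineDerivAt (v := ((0, Pi.single i 1) : PhaseSpace N)) hρc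
      (by fun_prop) hgC hg'C hgc hg'c
    · intro x
      exact P.hasLineDerivAt_gibbsDensity (T := T) (P.hasLineDerivAt_hamiltonian_unitP N x i)
    · exact fun x => hasLineDerivAt_partialP hgd i x
  have e' : ∫ x, P.gibbsDensity N T x * partialP i (partialP i f) x =
      T⁻¹ * ∫ x, x.2 i * partialP i f x * P.gibbsDensity N T x := by
    rw [e, ← integral_neg, ← integral_const_mul]
    congr 1
    funext x
    ring
  have hsplit : (fun x => (T_b * partialP i (partialP i f) x - x.2 i * partialP i f x) *
      P.gibbsDensity N T x) = fun x => T_b * (P.gibbsDensity N T x * partialP i (partialP i f) x) -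
        x.2 i * partialP i f x * P.gibbsDensity N T x := by
    funext x; ring
  rw [hsplit, integral_sub, integral_const_mul, e']
  · ring
  · exact ((hρc.mul hg'C).integrable_of_hasCompactSupport hg'c.mul_left).const_mul T_b
  · exact (((by fun_prop : Continuous fun x : PhaseSpace N => x.2 i).mul hgC).mul
      hρc).integrable_of_hasCompactSupport (hgc.mul_left.mul_right)

/-- **The generator against the Gibbs density.** For `f ∈ C²_c` and any bath temperatures,
`∫ (L_{T_L,T_R} f) e^{-H/T} dq dp
  = γ ∑_i ([i = 0](T_L/T - 1) + [i = N-1](T_R/T - 1)) ∫ p_i ∂_{p_i}f e^{-H/T}`: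
the Liouville part drops out and each bath contributes `(T_b/T - 1) ∫ p_b ∂_{p_b} f e^{-H/T}`.
[Cuneo–Eckmann–Hairer–Rey-Bellet 2018, §3.1, proof of Prop. 3.3; Bonetto–Lebowitz–Rey-Bellet
2000, §4.1] [folklore] -/
theorem integral_generator_mul_gibbsDensity (hU : ContDiff ℝ 1 P.U) (hV : ContDiff ℝ 1 P.V)
    (N : ℕ) (T T_L T_R : ℝ) {f : PhaseSpace N → ℝ} (hf : ContDiff ℝ 2 f)
    (hfc : HasCompactSupport f) :
    ∫ x, P.generator N T_L T_R f x * P.gibbsDensity N T x =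
      P.γ * ∑ i : Fin N, ((if i.val = 0 then T_L / T - 1 else 0) +
        (if i.val = N - 1 then T_R / T - 1 else 0)) *
          ∫ x, x.2 i * partialP i f x * P.gibbsDensity N T x := by
  have hf1 : ContDiff ℝ 1 f := hf.of_le (by norm_num)
  have hfd : Differentiable ℝ f := hf.differentiable two_ne_zero
  have hH1 : ContDiff ℝ 1 (P.hamiltonian N) := P.contDiff_hamiltonian hU hV N
  have hρc : Continuous (P.gibbsDensity N T) :=
    P.continuous_gibbsDensity hU.continuous hV.continuous N T
  -- regularity of the pieces
  have hQc : ∀ i, Continuous (partialQ i f) := fun i => continuous_partialQ hf1 one_ne_zero i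
  have hPc : ∀ i, Continuous (partialP i f) := fun i => continuous_partialP hf1 one_ne_zero i
  have hP1 : ∀ i, ContDiff ℝ 1 (partialP i f) := fun i => contDiff_partialP hf (by norm_num) i
  have hPPc : ∀ i, Continuous (partialP i (partialP i f)) := fun i =>
    continuous_partialP (hP1 i) one_ne_zero i
  have hQs : ∀ i, HasCompactSupport (partialQ i f) := fun i => hasCompactSupport_partialQ hfd hfc i
  have hPs : ∀ i, HasCompactSupport (partialP i f) := fun i => hasCompactSupport_partialP hfd hfc i
  have hPPs : ∀ i, HasCompactSupport (partialP i (partialP i f)) := fun i =>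
    hasCompactSupport_partialP ((hP1 i).differentiable one_ne_zero) (hPs i) i
  have hWc : ∀ i, Continuous (partialQ i (P.hamiltonian N)) := fun i =>
    P.continuous_partialQ_hamiltonian hH1 i
  -- integrability of the three families of terms
  have intA : ∀ i, Integrable (fun x => (x.2 i * partialQ i f x -
      partialQ i (P.hamiltonian N) x * partialP i f x) * P.gibbsDensity N T x) := by
    intro i
    refine Continuous.integrable_of_hasCompactSupport (by fun_prop) ?_
    exact (((hQs i).mul_left (f := fun x : PhaseSpace N => x.2 i)).sub
      ((hPs i).mul_left)).mul_right
  have intB : ∀ (i : Fin N) (c : Prop) [Decidable c] (Tb : ℝ), Integrable (fun x =>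
      (if c then Tb * partialP i (partialP i f) x - x.2 i * partialP i f x else 0) *
        P.gibbsDensity N T x) := by
    intro i c _ Tb
    by_cases hc : c
    · simp only [hc, if_true]
      refine Continuous.integrable_of_hasCompactSupport (by fun_prop) ?_
      exact (((hPPs i).mul_left).sub ((hPs i).mul_left)).mul_right
    · simp only [hc, if_false, zero_mul]
      exact integrable_zero _ _ _
  have intBC : ∀ i : Fin N, Integrable (fun x =>
      (if i.val = 0 then T_L * partialP i (partialP i f) x - x.2 i * partialP i f x else 0) *
          P.gibbsDensity N T x +
        (if i.val = N - 1 then T_R * partialP i (partialP i f) x - x.2 i * partialP i f x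
          else 0) * P.gibbsDensity N T x) :=
    fun i => (intB i _ T_L).add (intB i _ T_R)
  have valB : ∀ (i : Fin N) (c : Prop) [Decidable c] (Tb : ℝ), ∫ x,
      (if c then Tb * partialP i (partialP i f) x - x.2 i * partialP i f x else 0) *
        P.gibbsDensity N T x =
      (if c then Tb / T - 1 else 0) * ∫ x, x.2 i * partialP i f x * P.gibbsDensity N T x := by
    intro i c _ Tb
    by_cases hc : c
    · simp only [hc, if_true]
      exact P.integral_bath_mul_gibbsDensity hU hV N T Tb hf hfc i
    · simp only [hc, if_false, zero_mul, integral_zero]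
  -- pointwise splitting of the integrand
  have hsplit : (fun x => P.generator N T_L T_R f x * P.gibbsDensity N T x) = fun x =>
      (∑ i : Fin N, (x.2 i * partialQ i f x - partialQ i (P.hamiltonian N) x * partialP i f x) *
        P.gibbsDensity N T x) +
      P.γ * ∑ i : Fin N,
        ((if i.val = 0 then T_L * partialP i (partialP i f) x - x.2 i * partialP i f x else 0) *
            P.gibbsDensity N T x +
          (if i.val = N - 1 then T_R * partialP i (partialP i f) x - x.2 i * partialP i f x
            else 0) * P.gibbsDensity N T x) := by
    funext x
    simp only [generator, add_mul, Finset.sum_mul, mul_assoc]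
  rw [hsplit, integral_add, integral_const_mul, integral_finsetSum _ fun i _ => intA i,
    integral_finsetSum _ fun i _ => intBC i]
  · rw [Finset.sum_eq_zero fun i _ => P.integral_liouville_mul_gibbsDensity hU hV N T hf1 hfc i,
      zero_add]
    congr 1
    refine Finset.sum_congr rfl fun i _ => ?_
    rw [integral_add (intB i _ T_L) (intB i _ T_R), valB, valB]
    ring
  · exact integrable_finsetSum _ fun i _ => intA i
  · exact (integrable_finsetSum _ fun i _ => intBC i).const_mul _

end OscillatorChain

/-! ### The pinned anharmonic chain: bounds and integrability -/

section Pinned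

variable {ω₂ lam β : ℝ}

/-- For `c > 0`, `e^{-cH}` is Lebesgue integrable on phase space (domination by a product of
Gaussians, `H ≥ ∑ (ω₂ q_i² + p_i²)/2`). [folklore] -/
theorem pinnedChain_integrable_exp_neg_mul_hamiltonian (hω : 0 < ω₂) (hl : 0 ≤ lam) (hβ : 0 ≤ β)
    (γ : ℝ) (N : ℕ) {c : ℝ} (hc : 0 < c) :
    Integrable fun x : PhaseSpace N =>
      Real.exp (-(c * (pinnedChain ω₂ lam β γ).hamiltonian N x)) := by
  set g : PhaseSpace N → ℝ := fun x =>
    (∏ i, Real.exp (-(c * ω₂ / 2) * x.1 i ^ 2)) * ∏ i, Real.exp (-(c / 2) * x.2 i ^ 2) with hg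
  have hq : Integrable (fun q : Fin N → ℝ => ∏ i, Real.exp (-(c * ω₂ / 2) * q i ^ 2)) := by
    have := Integrable.fintype_prod (μ := fun _ : Fin N => (volume : Measure ℝ))
      (f := fun _ t => Real.exp (-(c * ω₂ / 2) * t ^ 2))
      (fun _ => integrable_exp_neg_mul_sq (by positivity))
    simpa [volume_pi] using this
  have hp : Integrable (fun p : Fin N → ℝ => ∏ i, Real.exp (-(c / 2) * p i ^ 2)) := by
    have := Integrable.fintype_prod (μ := fun _ : Fin N => (volume : Measure ℝ))
      (f := fun _ t => Real.exp (-(c / 2) * t ^ 2))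
      (fun _ => integrable_exp_neg_mul_sq (by positivity))
    simpa [volume_pi] using this
  have hgi : Integrable g := by
    have := hq.mul_prod hp
    simpa [hg, Measure.volume_eq_prod] using this
  have hHc : Continuous ((pinnedChain ω₂ lam β γ).hamiltonian N) :=
    (pinnedChain ω₂ lam β γ).continuous_hamiltonian
      (pinnedChain_contDiff_U ω₂ lam β γ (n := 0)).continuous
      (pinnedChain_contDiff_V ω₂ lam β γ (n := 0)).continuous N
  refine hgi.mono' (by fun_prop) (Filter.Eventually.of_forall fun x => ?_)
  rw [Real.norm_eq_abs, abs_of_pos (Real.exp_pos _)]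
  have hle := pinnedChain_harmonic_le_hamiltonian (ω₂ := ω₂) hl hβ γ N x
  have : g x = Real.exp (-(c * ((∑ i, ω₂ * x.1 i ^ 2 / 2) + ∑ i, x.2 i ^ 2 / 2))) := by
    simp only [hg, ← Real.exp_sum, ← Real.exp_add]
    congr 1
    simp only [neg_add, mul_add, Finset.mul_sum, ← Finset.sum_neg_distrib]
    congr 1 <;> exact Finset.sum_congr rfl fun i _ => by ring
  rw [this]
  exact Real.exp_le_exp.mpr (by nlinarith)

/-! ### Elementary inequalities used to dominate the currents -/

/-- The Gibbs density of the pinned chain is continuous. [folklore] -/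
theorem pinnedChain_continuous_gibbsDensity (ω₂ lam β γ : ℝ) (N : ℕ) (T : ℝ) :
    Continuous ((pinnedChain ω₂ lam β γ).gibbsDensity N T) :=
  (pinnedChain ω₂ lam β γ).continuous_gibbsDensity (pinnedChain_contDiff_U ω₂ lam β γ
    (n := 0)).continuous (pinnedChain_contDiff_V ω₂ lam β γ (n := 0)).continuous N T

/-- `e^{-H/T}` is integrable for `T > 0`: the partition function is finite. [folklore] -/
theorem pinnedChain_integrable_gibbsDensity (hω : 0 < ω₂) (hl : 0 ≤ lam) (hβ : 0 ≤ β) (γ : ℝ)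
    (N : ℕ) {T : ℝ} (hT : 0 < T) : Integrable ((pinnedChain ω₂ lam β γ).gibbsDensity N T) := by
  have h := pinnedChain_integrable_exp_neg_mul_hamiltonian hω hl hβ γ N (inv_pos.mpr hT)
  refine h.congr (Filter.Eventually.of_forall fun x => ?_)
  simp only [OscillatorChain.gibbsDensity]
  congr 1
  field_simp

/-- `e^{ϑ H} e^{-H/T}` is integrable for `ϑ < 1/T`. [folklore] -/
theorem pinnedChain_integrable_exp_mul_gibbsDensity (hω : 0 < ω₂) (hl : 0 ≤ lam) (hβ : 0 ≤ β)
    (γ : ℝ) (N : ℕ) {T ϑ : ℝ} (hT : 0 < T) (hϑ : ϑ < 1 / T) :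
    Integrable fun x => Real.exp (ϑ * (pinnedChain ω₂ lam β γ).hamiltonian N x) *
      (pinnedChain ω₂ lam β γ).gibbsDensity N T x := by
  have hc : 0 < 1 / T - ϑ := sub_pos.mpr hϑ
  have h := pinnedChain_integrable_exp_neg_mul_hamiltonian hω hl hβ γ N hc
  refine h.congr (Filter.Eventually.of_forall fun x => ?_)
  simp only [OscillatorChain.gibbsDensity, ← Real.exp_add]
  congr 1
  field_simp
  ring

/-- The bond currents are integrable against `e^{-H/T}` (`|j_i| e^{-H/T} ≤ K e^{-H/(2T)}`).
[folklore] -/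
theorem pinnedChain_integrable_bondCurrent_mul_gibbsDensity (hω : 0 < ω₂) (hl : 0 ≤ lam)
    (hβ : 0 ≤ β) (γ : ℝ) (N : ℕ) {T : ℝ} (hT : 0 < T) (i : Fin N) :
    Integrable fun x => (pinnedChain ω₂ lam β γ).bondCurrent N i x *
      (pinnedChain ω₂ lam β γ).gibbsDensity N T x := by
  have hs : 0 < T⁻¹ / 2 := by positivity
  have hmaj := (pinnedChain_integrable_exp_neg_mul_hamiltonian hω hl hβ γ N hs).const_mul
    (N * ((3 + β) / 2) * (2 * Real.exp (T⁻¹ / 2) / (T⁻¹ / 2) ^ 2))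
  refine hmaj.mono' (((pinnedChain_continuous_bondCurrent ω₂ lam β γ N i).mul
    (pinnedChain_continuous_gibbsDensity ω₂ lam β γ N T)).aestronglyMeasurable)
    (Filter.Eventually.of_forall fun x => ?_)
  have hH0 := pinnedChain_hamiltonian_nonneg hω.le hl hβ γ N x
  have hj := pinnedChain_abs_bondCurrent_le hω.le hl hβ γ N i x
  have hsq := one_add_sq_le_exp hH0 hs
  have hρ : 0 < (pinnedChain ω₂ lam β γ).gibbsDensity N T x :=
    (pinnedChain ω₂ lam β γ).gibbsDensity_pos N T x
  rw [Real.norm_eq_abs, abs_mul, abs_of_pos hρ]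
  have key : (1 + (pinnedChain ω₂ lam β γ).hamiltonian N x) ^ 2 *
      (pinnedChain ω₂ lam β γ).gibbsDensity N T x ≤
      2 * Real.exp (T⁻¹ / 2) / (T⁻¹ / 2) ^ 2 *
        Real.exp (-(T⁻¹ / 2 * (pinnedChain ω₂ lam β γ).hamiltonian N x)) := by
    have e : Real.exp (T⁻¹ / 2 * (pinnedChain ω₂ lam β γ).hamiltonian N x) *
        (pinnedChain ω₂ lam β γ).gibbsDensity N T x =
        Real.exp (-(T⁻¹ / 2 * (pinnedChain ω₂ lam β γ).hamiltonian N x)) := by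
      simp only [OscillatorChain.gibbsDensity, ← Real.exp_add]
      congr 1
      field_simp
      ring
    calc (1 + (pinnedChain ω₂ lam β γ).hamiltonian N x) ^ 2 *
          (pinnedChain ω₂ lam β γ).gibbsDensity N T x
        ≤ (2 * Real.exp (T⁻¹ / 2) / (T⁻¹ / 2) ^ 2 *
            Real.exp (T⁻¹ / 2 * (pinnedChain ω₂ lam β γ).hamiltonian N x)) *
            (pinnedChain ω₂ lam β γ).gibbsDensity N T x :=
          mul_le_mul_of_nonneg_right hsq hρ.le
      _ = 2 * Real.exp (T⁻¹ / 2) / (T⁻¹ / 2) ^ 2 *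
          Real.exp (-(T⁻¹ / 2 * (pinnedChain ω₂ lam β γ).hamiltonian N x)) := by
          rw [mul_assoc, e]
  calc |(pinnedChain ω₂ lam β γ).bondCurrent N i x| * (pinnedChain ω₂ lam β γ).gibbsDensity N T x
      ≤ N * ((3 + β) / 2 * (1 + (pinnedChain ω₂ lam β γ).hamiltonian N x) ^ 2) *
          (pinnedChain ω₂ lam β γ).gibbsDensity N T x := mul_le_mul_of_nonneg_right hj hρ.le
    _ = N * ((3 + β) / 2) * ((1 + (pinnedChain ω₂ lam β γ).hamiltonian N x) ^ 2 *
          (pinnedChain ω₂ lam β γ).gibbsDensity N T x) := by ring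
    _ ≤ N * ((3 + β) / 2) * (2 * Real.exp (T⁻¹ / 2) / (T⁻¹ / 2) ^ 2 *
          Real.exp (-(T⁻¹ / 2 * (pinnedChain ω₂ lam β γ).hamiltonian N x))) :=
          mul_le_mul_of_nonneg_left key (by positivity)
    _ = N * ((3 + β) / 2) * (2 * Real.exp (T⁻¹ / 2) / (T⁻¹ / 2) ^ 2) *
          Real.exp (-(T⁻¹ / 2 * (pinnedChain ω₂ lam β γ).hamiltonian N x)) := by ring

/-! ### The Gibbs state is a weak steady state -/

/-- For `ω₂ > 0`, `lam, β ≥ 0`, `T > 0` the Gibbs measure of the pinned chain is a probability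
measure (`0 < Z < ∞`). [folklore] -/
theorem pinnedChain_isProbabilityMeasure_gibbsMeasure (hω : 0 < ω₂) (hl : 0 ≤ lam) (hβ : 0 ≤ β)
    (γ : ℝ) (N : ℕ) {T : ℝ} (hT : 0 < T) :
    IsProbabilityMeasure ((pinnedChain ω₂ lam β γ).gibbsMeasure N T) :=
  (pinnedChain ω₂ lam β γ).isProbabilityMeasure_gibbsMeasure
    (pinnedChain_integrable_gibbsDensity hω hl hβ γ N hT)

/-- For the Gibbs measure `μ_T` of the pinned chain and `f ∈ C²_c`:
`∫ L_{T_L,T_R} f dμ_T = (∫ e^{-H/T})⁻¹ γ ∑_i c_i ∫ p_i ∂_{p_i} f e^{-H/T} dq dp` with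
`c_i = [i=0](T_L/T - 1) + [i=N-1](T_R/T - 1)`. [Cuneo–Eckmann–Hairer–Rey-Bellet
2018, §3.1, proof of Prop. 3.3] [folklore] -/
theorem pinnedChain_integral_generator_gibbsMeasure (ω₂ lam β γ : ℝ) (N : ℕ) (T T_L T_R : ℝ)
    {f : PhaseSpace N → ℝ} (hf : ContDiff ℝ 2 f) (hfc : HasCompactSupport f) :
    ∫ x, (pinnedChain ω₂ lam β γ).generator N T_L T_R f x
        ∂((pinnedChain ω₂ lam β γ).gibbsMeasure N T) =
      (∫ x, (pinnedChain ω₂ lam β γ).gibbsDensity N T x)⁻¹ *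
        ((pinnedChain ω₂ lam β γ).γ * ∑ i : Fin N, ((if i.val = 0 then T_L / T - 1 else 0) +
          (if i.val = N - 1 then T_R / T - 1 else 0)) *
            ∫ x, x.2 i * partialP i f x * (pinnedChain ω₂ lam β γ).gibbsDensity N T x) := by
  rw [(pinnedChain ω₂ lam β γ).integral_gibbsMeasure,
    (pinnedChain ω₂ lam β γ).integral_generator_mul_gibbsDensity (pinnedChain_contDiff_U ω₂ lam β γ)
      (pinnedChain_contDiff_V ω₂ lam β γ) N T T_L T_R hf hfc]

/-- **Equilibrium steady state (all `N`).** For the pinned anharmonic chain with `ω₂ > 0`,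
`lam, β ≥ 0`, any bath coupling `γ` and equal bath temperatures `T_L = T_R = T > 0`, the Gibbs
measure `Z⁻¹ e^{-H/T} dq dp` is a steady state in the weak Fokker–Planck sense
(`OscillatorChain.IsSteadyState`: probability measure, `∫ L f dμ = 0` for `f ∈ C_c^∞`, bond currents
integrable). [Bonetto–Lebowitz–Rey-Bellet 2000, §4.1; Cuneo–Eckmann–Hairer–Rey-Bellet 2018, §3.1,
proof of Prop. 3.3 ("the measure `Z⁻¹e^{-βH} dp dq` is invariant")]
[cite: CuneoEckmannHairerReyBellet2018, §3.1, proof of Prop. 3.3] -/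
theorem pinnedChain_isSteadyState_gibbsMeasure (hω : 0 < ω₂) (hl : 0 ≤ lam) (hβ : 0 ≤ β) (γ : ℝ)
    (N : ℕ) {T : ℝ} (hT : 0 < T) :
    (pinnedChain ω₂ lam β γ).IsSteadyState N T T ((pinnedChain ω₂ lam β γ).gibbsMeasure N T) := by
  refine ⟨pinnedChain_isProbabilityMeasure_gibbsMeasure hω hl hβ γ N hT, fun f hf hfc => ?_,
    fun i => ?_⟩
  · rw [pinnedChain_integral_generator_gibbsMeasure ω₂ lam β γ N T T T (hf.of_le (by norm_cast))
      hfc]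
    simp [div_self hT.ne']
  · exact (pinnedChain ω₂ lam β γ).integrable_gibbsMeasure
      (pinnedChain_integrable_bondCurrent_mul_gibbsDensity hω hl hβ γ N hT i)

/-- **One site (`N = 1`), arbitrary bath temperatures.** With a single oscillator both baths act
on the same momentum and add up to one Ornstein–Uhlenbeck bath of coupling `2γ` and temperature
`(T_L + T_R)/2`; the Gibbs measure at that temperature is a weak steady state.
[Cuneo–Eckmann–Hairer–Rey-Bellet 2018, §3.1, proof of Prop. 3.3] [folklore] -/
theorem pinnedChain_isSteadyState_gibbsMeasure_one (hω : 0 < ω₂) (hl : 0 ≤ lam) (hβ : 0 ≤ β)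
    (γ : ℝ) {T_L T_R : ℝ} (hL : 0 < T_L) (hR : 0 < T_R) :
    (pinnedChain ω₂ lam β γ).IsSteadyState 1 T_L T_R
      ((pinnedChain ω₂ lam β γ).gibbsMeasure 1 ((T_L + T_R) / 2)) := by
  have hT : 0 < (T_L + T_R) / 2 := by positivity
  refine ⟨pinnedChain_isProbabilityMeasure_gibbsMeasure hω hl hβ γ 1 hT, fun f hf hfc => ?_,
    fun i => ?_⟩
  · rw [pinnedChain_integral_generator_gibbsMeasure ω₂ lam β γ 1 _ T_L T_R
      (hf.of_le (by norm_cast)) hfc]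
    have h : T_L / ((T_L + T_R) / 2) - 1 + (T_R / ((T_L + T_R) / 2) - 1) = 0 := by
      field_simp
      ring
    simp [h]
  · exact (pinnedChain ω₂ lam β γ).integrable_gibbsMeasure
      (pinnedChain_integrable_bondCurrent_mul_gibbsDensity hω hl hβ γ 1 hT i)

/-- `e^{ϑH}` is integrable for the Gibbs measure at temperature `T` whenever `ϑ < 1/T`.
[Cuneo–Eckmann–Hairer–Rey-Bellet 2018, Thm 2.13(2) (equilibrium case)] [folklore] -/
theorem pinnedChain_integrable_exp_mul_hamiltonian_gibbsMeasure (hω : 0 < ω₂) (hl : 0 ≤ lam)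
    (hβ : 0 ≤ β) (γ : ℝ) (N : ℕ) {T ϑ : ℝ} (hT : 0 < T) (hϑ : ϑ < 1 / T) :
    Integrable (fun x => Real.exp (ϑ * (pinnedChain ω₂ lam β γ).hamiltonian N x))
      ((pinnedChain ω₂ lam β γ).gibbsMeasure N T) :=
  (pinnedChain ω₂ lam β γ).integrable_gibbsMeasure
    (pinnedChain_integrable_exp_mul_gibbsDensity hω hl hβ γ N hT hϑ)

/-- **Conclusion of the named fact `CuneoEckmannHairerReyBellet2018_pinnedChain`, equilibrium
case, proved outright.** For equal bath temperatures `T_L = T_R = T` (and every `N`, including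
`N = 0`) the conclusion of the weak corollary vendored in `LangevinChainNESS.lean` — existence of a
weak steady state, absolutely continuous, integrating `e^{ϑH}` for `0 < ϑ < 1/max(T,T)` — holds,
witnessed by the Gibbs measure. (This is NOT Thm 2.13 itself: uniqueness, smoothness of the
density and exponential convergence are not addressed here.)
[cite: CuneoEckmannHairerReyBellet2018, Thm 2.13 and §3.1] -/
theorem CuneoEckmannHairerReyBellet2018_pinnedChain_of_eq {ω₂ lam β : ℝ} (hω : 0 < ω₂)
    (hl : 0 ≤ lam) (hβ : 0 ≤ β) (γ : ℝ) (N : ℕ) {T : ℝ} (hT : 0 < T) :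
    ∃ μ : Measure (PhaseSpace N),
      (pinnedChain ω₂ lam β γ).IsSteadyState N T T μ ∧
      μ ≪ (volume : Measure (PhaseSpace N)) ∧
      ∀ ϑ : ℝ, 0 < ϑ → ϑ < 1 / max T T →
        Integrable (fun x => Real.exp (ϑ * (pinnedChain ω₂ lam β γ).hamiltonian N x)) μ :=
  ⟨_, pinnedChain_isSteadyState_gibbsMeasure hω hl hβ γ N hT,
    (pinnedChain ω₂ lam β γ).gibbsMeasure_absolutelyContinuous N T, fun ϑ _ hϑ =>
      pinnedChain_integrable_exp_mul_hamiltonian_gibbsMeasure hω hl hβ γ N hT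
        (by simpa using hϑ)⟩

/-- **Conclusion of the named fact `CuneoEckmannHairerReyBellet2018_pinnedChain`, one site,
proved outright.** For `N = 1` and arbitrary `T_L, T_R > 0` the conclusion of the weak corollary
(a weak steady state, absolutely continuous, integrating `e^{ϑH}` for `0 < ϑ < 1/max(T_L,T_R)`)
holds, witnessed by the Gibbs measure at the mean temperature `(T_L + T_R)/2`
(`1/max(T_L,T_R) ≤ 2/(T_L+T_R)`). (Again not Thm 2.13 itself.)
[cite: CuneoEckmannHairerReyBellet2018, Thm 2.13 and §3.1] -/
theorem CuneoEckmannHairerReyBellet2018_pinnedChain_one {ω₂ lam β : ℝ} (hω : 0 < ω₂)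
    (hl : 0 ≤ lam) (hβ : 0 ≤ β) (γ : ℝ) {T_L T_R : ℝ} (hL : 0 < T_L) (hR : 0 < T_R) :
    ∃ μ : Measure (PhaseSpace 1),
      (pinnedChain ω₂ lam β γ).IsSteadyState 1 T_L T_R μ ∧
      μ ≪ (volume : Measure (PhaseSpace 1)) ∧
      ∀ ϑ : ℝ, 0 < ϑ → ϑ < 1 / max T_L T_R →
        Integrable (fun x => Real.exp (ϑ * (pinnedChain ω₂ lam β γ).hamiltonian 1 x)) μ := by
  have hT : 0 < (T_L + T_R) / 2 := by positivity
  refine ⟨_, pinnedChain_isSteadyState_gibbsMeasure_one hω hl hβ γ hL hR,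
    (pinnedChain ω₂ lam β γ).gibbsMeasure_absolutelyContinuous 1 _, fun ϑ _ hϑ =>
      pinnedChain_integrable_exp_mul_hamiltonian_gibbsMeasure hω hl hβ γ 1 hT
        (lt_of_lt_of_le hϑ ?_)⟩
  have hmax : (T_L + T_R) / 2 ≤ max T_L T_R := by
    have h1 := le_max_left T_L T_R
    have h2 := le_max_right T_L T_R
    linarith
  exact one_div_le_one_div_of_le hT hmax

/-! ### No heat current at equilibrium -/

/-- Momentum reversal `(q, p) ↦ (q, -p)` as a measurable equivalence of phase space.
[folklore] -/
def momentumReversal (N : ℕ) : PhaseSpace N ≃ᵐ PhaseSpace N :=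
  MeasurableEquiv.prodCongr (MeasurableEquiv.refl _) (MeasurableEquiv.neg _)

/-- `momentumReversal (q, p) = (q, -p)`. [folklore] -/
@[simp] theorem momentumReversal_apply (N : ℕ) (x : PhaseSpace N) :
    momentumReversal N x = (x.1, -x.2) := rfl

/-- Momentum reversal preserves Lebesgue measure on phase space. [folklore] -/
theorem measurePreserving_momentumReversal (N : ℕ) :
    MeasurePreserving (momentumReversal N) (volume : Measure (PhaseSpace N)) volume :=
  (MeasurePreserving.id (volume : Measure (Fin N → ℝ))).prod
    (Measure.measurePreserving_neg (volume : Measure (Fin N → ℝ)))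

/-- `∫ g(q, -p) dq dp = ∫ g(q, p) dq dp`. [folklore] -/
theorem integral_comp_momentumReversal (N : ℕ) (g : PhaseSpace N → ℝ) :
    ∫ x : PhaseSpace N, g (x.1, -x.2) = ∫ x, g x :=
  (measurePreserving_momentumReversal N).integral_comp' (f := momentumReversal N) g

/-- The energy is even in the momenta. [folklore] -/
theorem OscillatorChain.hamiltonian_neg_momentum (P : OscillatorChain) (N : ℕ) (x : PhaseSpace N) :
    P.hamiltonian N (x.1, -x.2) = P.hamiltonian N x := by
  simp [OscillatorChain.hamiltonian]

/-- The bond currents are odd in the momenta. [folklore] -/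
theorem OscillatorChain.bondCurrent_neg_momentum (P : OscillatorChain) (N : ℕ) (i : Fin N)
    (x : PhaseSpace N) : P.bondCurrent N i (x.1, -x.2) = -P.bondCurrent N i x := by
  simp only [OscillatorChain.bondCurrent, Pi.neg_apply, ← Finset.sum_neg_distrib]
  refine Finset.sum_congr rfl fun j _ => ?_
  split_ifs
  · ring
  · simp

/-- **No current at equilibrium.** The integral of each bond current against the Gibbs measure
vanishes (the current is odd under momentum reversal, which preserves `e^{-H/T} dq dp`). Stated
for all parameters: the honest reading ("the current has mean zero") is for `ω₂ > 0`,
`lam, β ≥ 0`, `T > 0`, where the Gibbs measure is a probability measure and the current is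
integrable (`pinnedChain_integrable_bondCurrent_mul_gibbsDensity`,
`pinnedChain_isSteadyState_gibbsMeasure`); for other parameters the identity holds for the zero
measure (`gibbsMeasure_of_not_integrable`) or as a Bochner junk value.
[Bonetto–Lebowitz–Rey-Bellet 2000, §5.2] [folklore] -/
theorem pinnedChain_integral_bondCurrent_gibbsMeasure (ω₂ lam β γ : ℝ) (N : ℕ) (T : ℝ)
    (i : Fin N) :
    ∫ x, (pinnedChain ω₂ lam β γ).bondCurrent N i x ∂((pinnedChain ω₂ lam β γ).gibbsMeasure N T) =
      0 := by
  rw [(pinnedChain ω₂ lam β γ).integral_gibbsMeasure]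
  have h := integral_comp_momentumReversal N fun x =>
    (pinnedChain ω₂ lam β γ).bondCurrent N i x * (pinnedChain ω₂ lam β γ).gibbsDensity N T x
  simp only [OscillatorChain.bondCurrent_neg_momentum, OscillatorChain.gibbsDensity,
    OscillatorChain.hamiltonian_neg_momentum, neg_mul, integral_neg] at h
  have h0 : ∫ x, (pinnedChain ω₂ lam β γ).bondCurrent N i x *
      (pinnedChain ω₂ lam β γ).gibbsDensity N T x = 0 := by
    simp only [OscillatorChain.gibbsDensity]
    linarith
  rw [h0, mul_zero]

/-- **No current at equilibrium**: the space-summed steady current of the Gibbs state vanishes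
(same caveat as `pinnedChain_integral_bondCurrent_gibbsMeasure`: meaningful for `ω₂ > 0`,
`lam, β ≥ 0`, `T > 0`; a zero-measure/junk identity otherwise).
[Bonetto–Lebowitz–Rey-Bellet 2000, §5.2] [folklore] -/
theorem pinnedChain_totalCurrent_gibbsMeasure (ω₂ lam β γ : ℝ) (N : ℕ) (T : ℝ) :
    (pinnedChain ω₂ lam β γ).totalCurrent ((pinnedChain ω₂ lam β γ).gibbsMeasure N T) = 0 := by
  simp [OscillatorChain.totalCurrent, pinnedChain_integral_bondCurrent_gibbsMeasure]

end Pinned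

end Literature.MathematicalPhysics.KineticTheory.HeatConduction
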